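/-
Copyright: the b2b-balaban cell (near-miss cell 7), T⁴-continuum fan-out; row NE7b ROUND-2 swarm, seat
t4-ne7b-formalise-leaf-03 (row S12 «ASSEMBLY» of `t4/b2b-balaban-t4-ne7b-p1/LEAVES-NE7b.md`; node A12 of the typer's
`t4/formal/NE7b/DAG.md`).  Released under the licence of the surrounding project.
-/
import Summits.QuantumFields.BalabanUV.T4Continuum.Support.HistoryAssemblyRealisePrice
import Summits.QuantumFields.BalabanUV.T4Continuum.Support.HistoryAssemblyPedigreeLE
import Summits.QuantumFields.BalabanUV.T4Continuum.Support.HistoryRealisePedigree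
import Summits.QuantumFields.BalabanUV.T4Continuum.Support.HistoryGenForest
import Summits.QuantumFields.BalabanUV.T4Continuum.Support.HistoryGenOrder

/-!
# History assembly: the realised reading at the finest displayed grain (node A12-I.2a, ruling R-OWNER-22-13, row S12b)

Summits-side support file of the T⁴-continuum cell (rung (B)+1 on a FINITE torus only; NOT infinite volume, NOT the
mass gap, NOT the Clay statement; NOT a proof of the spine estimate NE7b).  Row **S12b** `HistoryAssemblyRealise` of the
ROUND-2 swarm table `t4/b2b-balaban-t4-ne7b-p1/LEAVES-NE7b.md` v3.1 (ruling R-OWNER-22-13, typer T-NE7b-6 «DE-SERIALISE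
A12-I.2», journal l.7536 ∕ l.7734), on top of row S12's LE chain (`HistoryAssemblyRealiseLE` p210803,
`HistoryAssemblyRealisePrice` p210969, `HistoryAssemblyPedigreeLE` p210854).

WHAT.  §1 **`structure RealisedPedigrees`** — the typer's A12-I.2a field list VERBATIM: per cutoff `K ≥ K₀` and term
`τ ∈ T K`, for the pedigree `ped K τ` (leaf-09) with region payloads `cellP K τ` and realising sets `Z K τ c`:
`realises : ∀ c, Realises L s (R K) ((ped K τ).toPGen (cellP K τ) c) (Z K τ c)` (leaf-08), `step_le`, `renew_step` (the
shapes of `timedLE_of_realises`), `uniqueParent`, `oldNodup` (leaf-09 `HistoryGenForest`), `oldestFirst` (the part list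
in print's canonical order, oldest line first = the hypotheses of `HistoryGenOrder.headOldest_of_parts`),
`pending : ∀ c ∈ liveC K τ, PendingAt …` and the TWO ROOT-CELL FIELDS `cell_mem` ∕ `cell_inj` KEPT DISPLAYED (A12-I.2b =
row S12c, leaf-01's S6 pt 3b–3c).  §2 field by field: **`realisedReading_of_pedigrees`** (→ `HistoryAssemblyRealiseLE.
RealisedReading`: `forest` := `forest_of_uniqueParent`, `headOldest` := `headOldest_of_parts` ∕ `headOldest_of_nil`,
`real` := `⟨Z K τ c, realises, pending⟩`) and **`pedigreeReadingLE_of_pedigrees`** (→ `HistoryAssemblyPedigreeLE.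
PedigreeReadingLE`: `timed` := leaf-08's `timedLE_of_realises`, `pending` := `lt_reach_genT_of_pendingAt`).  §3 the ENDs
**`hybridNE7_of_realisedPedigrees_canon`** (= `HistoryAssemblyRealiseLE.hybridNE7_of_realisedReading_canon` ∘ §2) and
**`hybridNE7_of_realisedPedigrees_printed`** (= `HistoryAssemblyRealisePrice.hybridNE7_of_realisedReading_printed` ∘ §2):
NE7b's COUNT exit (LE currency, `irThresholdTLE`) ∘ seam with the live structures read as realised pending pedigrees at
this grain and (second END) the prices read in print's currency.  [folklore] finite bookkeeping + composition of landed
lemmas by name; ONE new `structure … : Prop` (hypothesis shape, c1); no `[cite:]` tag, nothing printed asserted.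

HONEST DEPENDENCY (cell): continuum YM on T⁴ ⇐ BetaPertH ∧ nine spine estimates (0/9 proved); BetaPertH ⇐ (D1) ∧ (D4)
∧ CAP+tail.  Nothing of H3 ∕ (B) ∕ BetaPertH is discharged here; NE7b is NOT proved; no date.
-/

open Finset MeasureTheory
open Literature.MathematicalPhysics.QuantumFieldTheory.Balaban1983to89
open T4PersistenceDictionary T4PersistentHistoryCount T4BankedInduction T4PrintedShapeBanking
open T4WeightBudget T4GlobalDenominator T4LiveClassFibration T4LiveStructureGas T4LiveGasToTerms T4RecordPriceSeam
open T4PartnerMultiplicity T4IndicatorShell T4MatchingAssembly T4MatchingClosure T4MatchingClosureSocket T4Continuum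
open T4StabilitySocket T4BranchingRecordsGas T4TaggedShapeBanking T4CanonicalMenus T4RenewalChains
open Summit.QuantumFields.BalabanUV.T4Continuum.PlacementBatch
open Summit.QuantumFields.BalabanUV.T4Continuum.PlacementSkeleton
open Summit.QuantumFields.BalabanUV.T4Continuum.CountThresholdUniform
open Summit.QuantumFields.BalabanUV.T4Continuum.CountThresholdExit
open Summit.QuantumFields.BalabanUV.T4Continuum.CountSeamJunction
open Summit.QuantumFields.BalabanUV.T4Continuum.LateMergers
open Summit.QuantumFields.BalabanUV.T4Continuum.HistoryFlow
open Summit.QuantumFields.BalabanUV.T4Continuum.HistoryRegeneration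
open Summit.QuantumFields.BalabanUV.T4Continuum.HistoryTables
open Summit.QuantumFields.BalabanUV.T4Continuum.HistoryAssemblyTrees
open Summit.QuantumFields.BalabanUV.T4Continuum.HistoryAssemblyTerms
open Summit.QuantumFields.BalabanUV.T4Continuum.HistoryAssemblyPedigree
open Summit.QuantumFields.BalabanUV.T4Continuum.HistoryConstants
open Summit.QuantumFields.BalabanUV.T4Continuum.HistoryGen
open Literature.MathematicalPhysics.QuantumFieldTheory.Balaban1983to89.B13ScaleTransfer
open Summit.QuantumFields.BalabanUV.T4Continuum.ZoneSkeleton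
open Summit.QuantumFields.BalabanUV.T4Continuum.HistorySocketTH
open Summit.QuantumFields.BalabanUV.T4Continuum.HistoryCaps
open Summit.QuantumFields.BalabanUV.T4Continuum.HistoryAssemblyPrice
open Summit.QuantumFields.BalabanUV.T4Continuum.HistoryBankingLE
open Summit.QuantumFields.BalabanUV.T4Continuum.HistoryExitLE
open Summit.QuantumFields.BalabanUV.T4Continuum.HistoryAssemblyTermsLE
open Summit.QuantumFields.BalabanUV.T4Continuum.HistoryRealise
open Summit.QuantumFields.BalabanUV.T4Continuum.HistoryAssemblyRealiseLE
open Summit.QuantumFields.BalabanUV.T4Continuum.HistoryGenTimedLE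
open Summit.QuantumFields.BalabanUV.T4Continuum.HistoryAssemblyPedigreeLE
open Summit.QuantumFields.BalabanUV.T4Continuum.HistoryAssemblyRealisePrice

namespace Summit.QuantumFields.BalabanUV.T4Continuum.HistoryAssemblyRealise

noncomputable section

/-! ## §1 The realised reading at the finest displayed grain -/

section Reading

variable {ι α π γ : Type*} [DecidableEq α] [DecidableEq π] [DecidableEq γ] {d : ℕ}

/-- **THE TERMS READ AS REALISED PEDIGREES, FINEST GRAIN** (typer T-NE7b-6 ∕ R-OWNER-22-13 field list).  For every cutoff
`K ≥ K₀` and term `τ ∈ T K`: every component of `ped K τ` is REALISED by the blocked dynamics with realising set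
`Z K τ c`; components are observed by the cutoff; renewals are dated one step after the renewed part; parents are
unique and constituents are not repeated (⇒ forest); part lists are in canonical order, oldest line first
(⇒ `HeadOldest`); live components are PENDING at `K`; root cells of live components are cells of the root's age and
pairwise distinct (displayed; row S12c). [folklore] -/
structure RealisedPedigrees (L : ℕ) (s : ℕ → ℕ) (Cell : ℕ → ℕ → Finset γ) (K₀ : ℕ) (R : ℕ → ℕ → ℕ)
    (T : ℕ → Finset ι) (ped : ℕ → ι → Pedigree α π) (cellP : ℕ → ι → π → Pt d × Finset (Pt d))
    (Z : ℕ → ι → α → Finset (Pt d)) (liveC : ℕ → ι → Finset α) (cellOf : ℕ → ι → α → γ) : Prop where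
  /-- every component is realised by the blocked dynamics -/
  realises : ∀ K, K₀ ≤ K → ∀ τ ∈ T K, ∀ c, Realises L s (R K) ((ped K τ).toPGen (cellP K τ) c) (Z K τ c)
  /-- every component is observed by the cutoff -/
  step_le : ∀ K, K₀ ≤ K → ∀ τ ∈ T K, ∀ c, (ped K τ).step c ≤ K
  /-- encoding: a renewal is dated one step after the renewed part -/
  renew_step : ∀ K, K₀ ≤ K → ∀ τ ∈ T K, ∀ c c', Part.old c' true ∈ (ped K τ).parts c →
    (ped K τ).step c' + 1 = (ped K τ).step c
  /-- an old name is a part of at most one component -/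
  uniqueParent : ∀ K, K₀ ≤ K → ∀ τ ∈ T K, (ped K τ).UniqueParent
  /-- no repeated constituent -/
  oldNodup : ∀ K, K₀ ≤ K → ∀ τ ∈ T K, ∀ c, (ped K τ).OldNodup c
  /-- canonical order of the parts: the head part's line is oldest, strictly older than the component when there
  are several parts -/
  oldestFirst : ∀ K, K₀ ≤ K → ∀ τ ∈ T K, ∀ c p ps, (ped K τ).parts c = p :: ps →
    (∀ q ∈ ps, (ped K τ).partRoot c p ≤ (ped K τ).partRoot c q) ∧ (ps ≠ [] → (ped K τ).partRoot c p < (ped K τ).step c)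
  /-- live components are pending at the cutoff -/
  pending : ∀ K, K₀ ≤ K → ∀ τ ∈ T K, ∀ c ∈ liveC K τ,
    PendingAt L s (R K) ((ped K τ).toPGen (cellP K τ) c).lastStep (Z K τ c) K
  /-- the root cell of a live component is a cell of the root's age (row S12c) -/
  cell_mem : ∀ K, K₀ ≤ K → ∀ τ ∈ T K, ∀ c ∈ liveC K τ, cellOf K τ c ∈ Cell K (K - ((ped K τ).genT c).rootStep)
  /-- distinct live components of one term have distinct root cells (row S12c) -/
  cell_inj : ∀ K, K₀ ≤ K → ∀ τ ∈ T K, Set.InjOn (cellOf K τ) (liveC K τ : Set α)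

end Reading

/-! ## §2 Field by field: the two coarser readings -/

section ToReadings

variable {ι α π γ : Type*} [DecidableEq α] [DecidableEq π] [DecidableEq γ] {d : ℕ} {L : ℕ} {s : ℕ → ℕ}
  {C : T4PrintedShapeBanking.Consts} {Cell : ℕ → ℕ → Finset γ} {K₀ : ℕ} {R : ℕ → ℕ → ℕ} {T : ℕ → Finset ι}
  {ped : ℕ → ι → Pedigree α π} {cellP : ℕ → ι → π → Pt d × Finset (Pt d)} {Z : ℕ → ι → α → Finset (Pt d)}
  {liveC : ℕ → ι → Finset α} {cellOf : ℕ → ι → α → γ}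

omit [DecidableEq α] [DecidableEq π] in
/-- `HeadOldest` from the canonical order of the part list (`headOldest_of_parts` ∕ `headOldest_of_nil`). [folklore] -/
theorem headOldest_of_oldestFirst (P : Pedigree α π)
    (h : ∀ c p ps, P.parts c = p :: ps →
      (∀ q ∈ ps, P.partRoot c p ≤ P.partRoot c q) ∧ (ps ≠ [] → P.partRoot c p < P.step c)) (c : α) :
    P.HeadOldest c := by
  rcases hps : P.parts c with _ | ⟨p, ps⟩
  · exact Pedigree.headOldest_of_nil hps
  · exact Pedigree.headOldest_of_parts hps (h c p ps hps).1 (h c p ps hps).2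

omit [DecidableEq π] [DecidableEq γ] in
/-- **THE FINEST READING GIVES THE GEOMETRIC READING** of `HistoryAssemblyRealiseLE`: `forest` by leaf-09's
`forest_of_uniqueParent`, `headOldest` by `headOldest_of_oldestFirst`, `real` from `realises` + `pending`. [folklore] -/
theorem realisedReading_of_pedigrees (H : RealisedPedigrees L s Cell K₀ R T ped cellP Z liveC cellOf) :
    RealisedReading L s Cell K₀ R T ped cellP liveC cellOf where
  renew_step := H.renew_step
  forest K hK τ hτ c := Pedigree.forest_of_uniqueParent (H.uniqueParent K hK τ hτ) (H.oldNodup K hK τ hτ) c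
  headOldest K hK τ hτ c := headOldest_of_oldestFirst (ped K τ) (H.oldestFirst K hK τ hτ) c
  real K hK τ hτ c hc := ⟨Z K τ c, H.realises K hK τ hτ c, H.pending K hK τ hτ c hc⟩
  cell_mem := H.cell_mem
  cell_inj := H.cell_inj

omit [DecidableEq π] [DecidableEq γ] in
/-- **THE FINEST READING GIVES THE `TimedLE` READING** of `HistoryAssemblyPedigreeLE` under leaf-08's side conditions:
`timed` by `timedLE_of_realises` (row S1b part 4), `pending` by `lt_reach_genT_of_pendingAt`. [folklore] -/
theorem pedigreeReadingLE_of_pedigrees (hL : 4 ≤ L) (hdrop : ∀ m, B16SProfile.DropCtl s m) (hn₁ : 13 ≤ C.n₁)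
    (hR1 : ∀ K, K₀ ≤ K → ∀ t, 1 ≤ R K t) (H : RealisedPedigrees L s Cell K₀ R T ped cellP Z liveC cellOf) :
    PedigreeReadingLE C Cell K₀ R T ped liveC cellOf where
  timed K hK τ hτ :=
    timedLE_of_realises (ped K τ) (cellP K τ) hL hdrop (hR1 K hK) C hn₁ (H.step_le K hK τ hτ)
      (H.renew_step K hK τ hτ) fun c => ⟨Z K τ c, H.realises K hK τ hτ c⟩
  forest K hK τ hτ c := Pedigree.forest_of_uniqueParent (H.uniqueParent K hK τ hτ) (H.oldNodup K hK τ hτ) c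
  headOldest K hK τ hτ c := headOldest_of_oldestFirst (ped K τ) (H.oldestFirst K hK τ hτ) c
  pending K hK τ hτ c hc :=
    lt_reach_genT_of_pendingAt hL hdrop (hR1 K hK) C hn₁ (ped K τ) (cellP K τ) (H.renew_step K hK τ hτ)
      (H.realises K hK τ hτ c) (H.pending K hK τ hτ c hc)
  cell_mem := H.cell_mem
  cell_inj := H.cell_inj

end ToReadings

/-! ## §3 The ENDs at this grain -/

section EndCanon

variable {F : T4Family} {G : Type*} [GaugeGroup G] [MeasurableSpace G] [HaarData G] [RegularGaugeGroup G]
variable {α π : Type*} [DecidableEq α] [DecidableEq π] {dP : ℕ} {sP : ℕ → ℕ}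
variable {ι : Type*} [DecidableEq ι] {l₀ vol : ℝ} {K₀ : ℕ} {T : ℕ → Finset ι} {A A' shA shB : ℕ → ℝ → ι → ℝ}
  {dead dead' : ℕ → ℝ → ι → ℝ} {nup mup : ℕ → ℝ → ℝ} {Nup : ℝ}
  {Cc Rr CcRec RrRec : ℕ → ℝ → ι → ℝ} {ν u s₂ q₀ r s Wsh : ℕ → ℝ}

/-- **NE7b's COUNT EXIT WITH THE LIVE STRUCTURES READ AS REALISED PEDIGREES, FINEST GRAIN** (LE currency, shape-free
threshold; no timing display): `HistoryAssemblyRealiseLE.hybridNE7_of_realisedReading_canon` with the geometric reading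
SUPPLIED by `realisedReading_of_pedigrees` from the displayed `RealisedPedigrees` (typer T-NE7b-6 field list: `realises`,
`step_le`, `renew_step`, `uniqueParent`, `oldNodup`, `oldestFirst`, `pending`, and the two root-cell fields of row S12c).
Everything else as there. [folklore] -/
theorem hybridNE7_of_realisedPedigrees_canon (D : FiniteEpsData F G) {C : T4PrintedShapeBanking.Consts}
    {rr : ℕ} {β₀ : ℝ} (h : ThresholdOK C F.L rr β₀) (hμ : 0 < C.μ) (d n : ℕ)
    (hκ₁ : (d : ℝ) * Real.log F.L + 2 * Real.log 2 ≤ C.κ₁) (hE₀ : Real.log (2 + birthMass C) ≤ C.E₀)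
    -- the flow side (⇐ BetaPertH, displayed) and tuning
    {γ₀ γb b β' : ℝ} {pe : ℕ} (hb : 0 ≤ b) (hlo : FlowStep.BetaLowerH b γ₀ D.βfun)
    (hhi : FlowStep.BetaUpperH β' γ₀ D.βfun) (hγ : γb ≤ γ₀) (hγβ : γb ^ 2 * β' < 1)
    (S : B14FlowStep.SmallnessFor γb β' β₀ F.L pe) (hp₀ : C.p₀ ≤ pe) (hrr : rr ≤ pe)
    {g : ℝ} {g₀ : ℕ → ℝ} (ht : D.Tuned γb g g₀)
    (hir : irThresholdTLE C F.L rr β₀ ≤ Real.log (g ^ 2)⁻¹)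
    -- the (B) side
    (hsign : B16.SignConventions D.C) {γB : ℝ} {em ep : ℝ → ℝ} (hcor : B16.Cor3With D.C γB em ep) (hγB : γb ≤ γB)
    {obs : (K : ℕ) → GaugeField (F.P K) 0 G → ℝ} {B : ℝ}
    (hobs : ∀ K, Measurable (obs K)) (hbd : ∀ K U, |obs K U| ≤ B)
    (hα : ∀ K t, |t| ≤ l₀ → K₀ ≤ K →
      ∫ U, Real.exp (t * obs K U) * D.dens K (g₀ K) 0 U ∂fieldMeasure (F.P K) 0 G ≤ ∑ τ ∈ T K, A K t τ)
    (hα' : ∀ K t, |t| ≤ l₀ → K₀ ≤ K →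
      ∫ U, Real.exp (t * obs (K + 1) U) * D.dens (K + 1) (g₀ (K + 1)) 0 U ∂fieldMeasure (F.P (K + 1)) 0 G ≤
        ∑ τ ∈ T K, A' K t τ)
    {c₀ n₁ : ℝ} (hc₀ : 0 < c₀) (hfloor : ∀ K, K₀ ≤ K → c₀ ≤ smallFieldMass D K (g₀ K))
    (hfloor' : ∀ K, K₀ ≤ K → c₀ ≤ smallFieldMass D (K + 1) (g₀ (K + 1)))
    (hsites : ∀ K, K₀ ≤ K → ((D.C ⟨K, F.m, g₀ K⟩).numSites K : ℝ) ≤ n₁)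
    (hsites' : ∀ K, K₀ ≤ K → ((D.C ⟨K + 1, F.m, g₀ (K + 1)⟩).numSites (K + 1) : ℝ) ≤ n₁)
    (hNup : 0 ≤ Nup) (hnup : ∀ K t, |t| ≤ l₀ → K₀ ≤ K → 0 ≤ nup K t ∧ nup K t ≤ Nup)
    (hmup : ∀ K t, |t| ≤ l₀ → K₀ ≤ K → 0 ≤ mup K t ∧ mup K t ≤ Nup)
    -- the (2.5) side condition on the size function
    (R : ℕ → ℕ → ℕ) (hR : ∀ K s, s ≤ K → B14.IsRj F.L rr ((D.C ⟨K, F.m, g₀ K⟩).flow.g s) (R K s))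
    -- the side conditions of the geometric lemmas (row S1b): torus side, drop control, size function, window constant
    (hL4 : 4 ≤ F.L) (hdrop : ∀ m, B16SProfile.DropCtl sP m) (hn₁ : 13 ≤ C.n₁) (hR1 : ∀ K, K₀ ≤ K → ∀ t, 1 ≤ R K t)
    -- H3: the terms read as REALISED PENDING PEDIGREES of live components with root cells
    (ped : ℕ → ι → Pedigree α π) (cellP : ℕ → ι → π → Pt dP × Finset (Pt dP)) (liveC : ℕ → ι → Finset α)
    (Z : ℕ → ι → α → Finset (Pt dP)) (cellOf : ℕ → ι → α → (Fin d → ℕ))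
    (H : RealisedPedigrees F.L sP (cellN d n F.L) K₀ R T ped cellP Z liveC cellOf)
    {Fc Rf Fc' Rf' : ℕ → Finset (BSlot (Fin d → ℕ) PEv) → ℝ}
    (hprice : ∀ K t, |t| ≤ l₀ → K₀ ≤ K → ∀ τ ∈ badTerms (memOf ped liveC cellOf) jhalf T K,
      Fc K (bstrOf Prod.fst (memOf ped liveC cellOf) K τ) * Rf K (bstrOf Prod.fst (memOf ped liveC cellOf) K τ) ≤
        ∏ q ∈ memOf ped liveC cellOf K τ,
          priceT Prod.fst C ((F.L : ℝ) ^ d) R (fun K => (D.C ⟨K, F.m, g₀ K⟩).flow.g) K q)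
    (hprice' : ∀ K t, |t| ≤ l₀ → K₀ ≤ K → ∀ τ ∈ badTerms (memOf ped liveC cellOf) jhalf T K,
      Fc' K (bstrOf Prod.fst (memOf ped liveC cellOf) K τ) * Rf' K (bstrOf Prod.fst (memOf ped liveC cellOf) K τ) ≤
        ∏ q ∈ memOf ped liveC cellOf K τ,
          priceT Prod.fst C ((F.L : ℝ) ^ d) R (fun K => (D.C ⟨K, F.m, g₀ K⟩).flow.g) K q)
    -- H3: the remaining `Regeneration` numerator readings, over the classes of the terms
    (up : ∀ K t, |t| ≤ l₀ → K₀ ≤ K → ∀ c ∈ badClasses Prod.fst (memOf ped liveC cellOf) jhalf T K,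
      ∀ τ ∈ fibre (bstrOf Prod.fst (memOf ped liveC cellOf)) T K c, A K t τ ≤ dead K t τ * Fc K c * nup K t)
    (dead_nonneg : ∀ K t, |t| ≤ l₀ → K₀ ≤ K → ∀ c ∈ badClasses Prod.fst (memOf ped liveC cellOf) jhalf T K,
      ∀ τ ∈ fibre (bstrOf Prod.fst (memOf ped liveC cellOf)) T K c, 0 ≤ dead K t τ)
    (resum : ∀ K t, |t| ≤ l₀ → K₀ ≤ K → ∀ c ∈ badClasses Prod.fst (memOf ped liveC cellOf) jhalf T K,
      ∑ τ ∈ fibre (bstrOf Prod.fst (memOf ped liveC cellOf)) T K c, dead K t τ ≤ Rf K c)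
    (F_nonneg : ∀ K t, |t| ≤ l₀ → K₀ ≤ K → ∀ c ∈ badClasses Prod.fst (memOf ped liveC cellOf) jhalf T K, 0 ≤ Fc K c)
    (up' : ∀ K t, |t| ≤ l₀ → K₀ ≤ K → ∀ c ∈ badClasses Prod.fst (memOf ped liveC cellOf) jhalf T K,
      ∀ τ ∈ fibre (bstrOf Prod.fst (memOf ped liveC cellOf)) T K c, A' K t τ ≤ dead' K t τ * Fc' K c * mup K t)
    (dead'_nonneg : ∀ K t, |t| ≤ l₀ → K₀ ≤ K → ∀ c ∈ badClasses Prod.fst (memOf ped liveC cellOf) jhalf T K,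
      ∀ τ ∈ fibre (bstrOf Prod.fst (memOf ped liveC cellOf)) T K c, 0 ≤ dead' K t τ)
    (resum' : ∀ K t, |t| ≤ l₀ → K₀ ≤ K → ∀ c ∈ badClasses Prod.fst (memOf ped liveC cellOf) jhalf T K,
      ∑ τ ∈ fibre (bstrOf Prod.fst (memOf ped liveC cellOf)) T K c, dead' K t τ ≤ Rf' K c)
    (F'_nonneg : ∀ K t, |t| ≤ l₀ → K₀ ≤ K → ∀ c ∈ badClasses Prod.fst (memOf ped liveC cellOf) jhalf T K,
      0 ≤ Fc' K c)
    -- the seam's other inputs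
    (hSh : ShellWeightBound l₀ T A A' shA shB Wsh)
    (hTB : ReindexedBudget l₀ vol T (fun K t τ => A K t τ - shA K t τ) (fun K t τ => A' K t τ - shB K t τ)
      (badOfClass (bstrOf Prod.fst (memOf ped liveC cellOf)) T
        (fun K _ => badClasses Prod.fst (memOf ped liveC cellOf) jhalf T K)) Cc Rr CcRec RrRec ν u s₂ q₀ r s)
    (hr : Summable r) (hu : Summable u) (hs : Summable s) (hs₂ : Summable s₂) :
    ∃ K₁ K₂, K₀ ≤ K₁ ∧ HybridNE7 l₀ vol (fun K => T (K₁ + (K₂ + K))) (fun K => A (K₁ + (K₂ + K)))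
      (fun K => A' (K₁ + (K₂ + K)))
      (fun K => badOfClass (bstrOf Prod.fst (memOf ped liveC cellOf)) T
        (fun K _ => badClasses Prod.fst (memOf ped liveC cellOf) jhalf T K) (K₁ + (K₂ + K)))
      (fun K => constOf l₀ B (max (em g) 0) n₁ c₀ Nup *
        recordsBudget (birthMass C) C.κ₁ ((n : ℝ) ^ d) ((F.L : ℝ) ^ d) (Real.log 2) jhalf (K₁ + (K₂ + K)))
      (fun K => shA (K₁ + (K₂ + K))) (fun K => shB (K₁ + (K₂ + K))) (fun K => Wsh (K₁ + (K₂ + K)))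
      (fun K => (r (K₁ + (K₂ + K)) + u (K₁ + (K₂ + K))) + (s (K₁ + (K₂ + K)) + s₂ (K₁ + (K₂ + K)))) :=
  hybridNE7_of_termReadingLE_canon D Prod.fst h hμ d n (dcapOf Prod.fst T (memOf ped liveC cellOf))
    (ncapOf T (memOf ped liveC cellOf)) hκ₁ hE₀ hb hlo hhi hγ hγβ S hp₀ hrr ht hir hsign hcor hγB hobs hbd hα hα' hc₀
    hfloor hfloor' hsites hsites' hNup hnup hmup R hR (memOf ped liveC cellOf) (termReadingLE_of_realised hL4 hdrop hn₁ hR1 (realisedReading_of_pedigrees H) jhalf) hprice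
    hprice' up dead_nonneg resum F_nonneg up' dead'_nonneg resum' F'_nonneg hSh hTB hr hu hs hs₂

end EndCanon

/-! ## §4 The printed-price END at this grain -/


section EndPrinted

variable {F : T4Family} {G : Type*} [GaugeGroup G] [MeasurableSpace G] [HaarData G] [RegularGaugeGroup G]
variable {α π : Type*} [DecidableEq α] [DecidableEq π] {dP : ℕ} {sP : ℕ → ℕ}
variable {ι : Type*} [DecidableEq ι] {l₀ vol : ℝ} {K₀ : ℕ} {T : ℕ → Finset ι} {A A' shA shB : ℕ → ℝ → ι → ℝ}
  {dead dead' : ℕ → ℝ → ι → ℝ} {nup mup : ℕ → ℝ → ℝ} {Nup : ℝ}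
  {Cc Rr CcRec RrRec : ℕ → ℝ → ι → ℝ} {ν u s₂ q₀ r s Wsh : ℕ → ℝ}

/-- **… AND THE PRICES READ IN PRINT'S CURRENCY**: `HistoryAssemblyRealisePrice.hybridNE7_of_realisedReading_printed`
composed the same way (equivalently `HistoryAssemblyRealiseLE.hybridNE7_of_realisedReading_canon` with the reading from
`realisedReading_of_pedigrees` and the prices from `HistoryAssemblyPrice.hprice_of_printed`). [folklore] -/
theorem hybridNE7_of_realisedPedigrees_printed (D : FiniteEpsData F G) {C : T4PrintedShapeBanking.Consts}
    {O : PrintedO1s} (hD : Dominates C O)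
    {rr : ℕ} {β₀ : ℝ} (h : ThresholdOK C F.L rr β₀) (hμ : 0 < C.μ) (d n : ℕ)
    (hκ₁ : (d : ℝ) * Real.log F.L + 2 * Real.log 2 ≤ C.κ₁) (hE₀ : Real.log (2 + birthMass C) ≤ C.E₀)
    -- the flow side (⇐ BetaPertH, displayed) and tuning
    {γ₀ γb b β' : ℝ} {pe : ℕ} (hb : 0 ≤ b) (hlo : FlowStep.BetaLowerH b γ₀ D.βfun)
    (hhi : FlowStep.BetaUpperH β' γ₀ D.βfun) (hγ : γb ≤ γ₀) (hγβ : γb ^ 2 * β' < 1)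
    (S : B14FlowStep.SmallnessFor γb β' β₀ F.L pe) (hp₀ : C.p₀ ≤ pe) (hrr : rr ≤ pe)
    {g : ℝ} {g₀ : ℕ → ℝ} (ht : D.Tuned γb g g₀)
    (hir : irThresholdTLE C F.L rr β₀ ≤ Real.log (g ^ 2)⁻¹)
    -- the (B) side
    (hsign : B16.SignConventions D.C) {γB : ℝ} {em ep : ℝ → ℝ} (hcor : B16.Cor3With D.C γB em ep) (hγB : γb ≤ γB)
    {obs : (K : ℕ) → GaugeField (F.P K) 0 G → ℝ} {B : ℝ}
    (hobs : ∀ K, Measurable (obs K)) (hbd : ∀ K U, |obs K U| ≤ B)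
    (hα : ∀ K t, |t| ≤ l₀ → K₀ ≤ K →
      ∫ U, Real.exp (t * obs K U) * D.dens K (g₀ K) 0 U ∂fieldMeasure (F.P K) 0 G ≤ ∑ τ ∈ T K, A K t τ)
    (hα' : ∀ K t, |t| ≤ l₀ → K₀ ≤ K →
      ∫ U, Real.exp (t * obs (K + 1) U) * D.dens (K + 1) (g₀ (K + 1)) 0 U ∂fieldMeasure (F.P (K + 1)) 0 G ≤
        ∑ τ ∈ T K, A' K t τ)
    {c₀ n₁ : ℝ} (hc₀ : 0 < c₀) (hfloor : ∀ K, K₀ ≤ K → c₀ ≤ smallFieldMass D K (g₀ K))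
    (hfloor' : ∀ K, K₀ ≤ K → c₀ ≤ smallFieldMass D (K + 1) (g₀ (K + 1)))
    (hsites : ∀ K, K₀ ≤ K → ((D.C ⟨K, F.m, g₀ K⟩).numSites K : ℝ) ≤ n₁)
    (hsites' : ∀ K, K₀ ≤ K → ((D.C ⟨K + 1, F.m, g₀ (K + 1)⟩).numSites (K + 1) : ℝ) ≤ n₁)
    (hNup : 0 ≤ Nup) (hnup : ∀ K t, |t| ≤ l₀ → K₀ ≤ K → 0 ≤ nup K t ∧ nup K t ≤ Nup)
    (hmup : ∀ K t, |t| ≤ l₀ → K₀ ≤ K → 0 ≤ mup K t ∧ mup K t ≤ Nup)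
    -- the (2.5) side condition on the size function
    (R : ℕ → ℕ → ℕ) (hR : ∀ K s, s ≤ K → B14.IsRj F.L rr ((D.C ⟨K, F.m, g₀ K⟩).flow.g s) (R K s))
    -- H3: the terms read as PEDIGREES of live components with root cells, and their reading
    -- the side conditions of the geometric lemmas (row S1b): torus side, drop control, window constant, size function
    (hL4 : 4 ≤ F.L) (hdrop : ∀ m, B16SProfile.DropCtl sP m) (hn₁ : 13 ≤ C.n₁) (hR1 : ∀ K, K₀ ≤ K → ∀ t, 1 ≤ R K t)
    (ped : ℕ → ι → Pedigree α π) (cellP : ℕ → ι → π → Pt dP × Finset (Pt dP)) (liveC : ℕ → ι → Finset α)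
    (Z : ℕ → ι → α → Finset (Pt dP)) (cellOf : ℕ → ι → α → (Fin d → ℕ))
    (H : RealisedPedigrees F.L sP (cellN d n F.L) K₀ R T ped cellP Z liveC cellOf)
    -- H3: realised per-step costs of the live members, read below the model's booked cost (reading (ID-a))
    (κ κ' : ℕ → (Fin d → ℕ) × Gen (Lab α π) → Gen (Lab α π) → ℕ → ℝ)
    (hκ : ∀ K, K₀ ≤ K → ∀ τ ∈ badTerms (memOf ped liveC cellOf) jhalf T K, ∀ q ∈ memOf ped liveC cellOf K τ,
      ∀ m ∈ life (padW (dictWT Prod.fst (R K) C.n₁) 0) q.2,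
        κ K q q.2 m ≤ costT Prod.fst C K (R K) q.2 m)
    (hκ' : ∀ K, K₀ ≤ K → ∀ τ ∈ badTerms (memOf ped liveC cellOf) jhalf T K, ∀ q ∈ memOf ped liveC cellOf K τ,
      ∀ m ∈ life (padW (dictWT Prod.fst (R K) C.n₁) 0) q.2,
        κ' K q q.2 m ≤ costT Prod.fst C K (R K) q.2 m)
    -- H3: the per-term price sentence in PRINT's currency, both runs
    {Fc Rf Fc' Rf' : ℕ → Finset (BSlot (Fin d → ℕ) PEv) → ℝ}
    (hP : ∀ K t, |t| ≤ l₀ → K₀ ≤ K → ∀ τ ∈ badTerms (memOf ped liveC cellOf) jhalf T K,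
      Fc K (HistorySocketTH.bstrOf Prod.fst (memOf ped liveC cellOf) K τ) *
          Rf K (HistorySocketTH.bstrOf Prod.fst (memOf ped liveC cellOf) K τ) ≤
        ∏ q ∈ memOf ped liveC cellOf K τ,
          pshapeTH Prod.fst O C 1 ((F.L : ℝ) ^ d) (R K) (D.C ⟨K, F.m, g₀ K⟩).flow.g 0 (κ K q) q.2)
    (hP' : ∀ K t, |t| ≤ l₀ → K₀ ≤ K → ∀ τ ∈ badTerms (memOf ped liveC cellOf) jhalf T K,
      Fc' K (HistorySocketTH.bstrOf Prod.fst (memOf ped liveC cellOf) K τ) *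
          Rf' K (HistorySocketTH.bstrOf Prod.fst (memOf ped liveC cellOf) K τ) ≤
        ∏ q ∈ memOf ped liveC cellOf K τ,
          pshapeTH Prod.fst O C 1 ((F.L : ℝ) ^ d) (R K) (D.C ⟨K, F.m, g₀ K⟩).flow.g 0 (κ' K q) q.2)
    -- H3: the remaining `Regeneration` numerator readings, over the classes of the terms
    (up : ∀ K t, |t| ≤ l₀ → K₀ ≤ K → ∀ c ∈ badClasses Prod.fst (memOf ped liveC cellOf) jhalf T K,
      ∀ τ ∈ fibre (HistorySocketTH.bstrOf Prod.fst (memOf ped liveC cellOf)) T K c,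
        A K t τ ≤ dead K t τ * Fc K c * nup K t)
    (dead_nonneg : ∀ K t, |t| ≤ l₀ → K₀ ≤ K → ∀ c ∈ badClasses Prod.fst (memOf ped liveC cellOf) jhalf T K,
      ∀ τ ∈ fibre (HistorySocketTH.bstrOf Prod.fst (memOf ped liveC cellOf)) T K c, 0 ≤ dead K t τ)
    (resum : ∀ K t, |t| ≤ l₀ → K₀ ≤ K → ∀ c ∈ badClasses Prod.fst (memOf ped liveC cellOf) jhalf T K,
      ∑ τ ∈ fibre (HistorySocketTH.bstrOf Prod.fst (memOf ped liveC cellOf)) T K c, dead K t τ ≤ Rf K c)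
    (F_nonneg : ∀ K t, |t| ≤ l₀ → K₀ ≤ K → ∀ c ∈ badClasses Prod.fst (memOf ped liveC cellOf) jhalf T K, 0 ≤ Fc K c)
    (up' : ∀ K t, |t| ≤ l₀ → K₀ ≤ K → ∀ c ∈ badClasses Prod.fst (memOf ped liveC cellOf) jhalf T K,
      ∀ τ ∈ fibre (HistorySocketTH.bstrOf Prod.fst (memOf ped liveC cellOf)) T K c,
        A' K t τ ≤ dead' K t τ * Fc' K c * mup K t)
    (dead'_nonneg : ∀ K t, |t| ≤ l₀ → K₀ ≤ K → ∀ c ∈ badClasses Prod.fst (memOf ped liveC cellOf) jhalf T K,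
      ∀ τ ∈ fibre (HistorySocketTH.bstrOf Prod.fst (memOf ped liveC cellOf)) T K c, 0 ≤ dead' K t τ)
    (resum' : ∀ K t, |t| ≤ l₀ → K₀ ≤ K → ∀ c ∈ badClasses Prod.fst (memOf ped liveC cellOf) jhalf T K,
      ∑ τ ∈ fibre (HistorySocketTH.bstrOf Prod.fst (memOf ped liveC cellOf)) T K c, dead' K t τ ≤ Rf' K c)
    (F'_nonneg : ∀ K t, |t| ≤ l₀ → K₀ ≤ K → ∀ c ∈ badClasses Prod.fst (memOf ped liveC cellOf) jhalf T K,
      0 ≤ Fc' K c)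
    -- the seam's other inputs
    (hSh : ShellWeightBound l₀ T A A' shA shB Wsh)
    (hTB : ReindexedBudget l₀ vol T (fun K t τ => A K t τ - shA K t τ) (fun K t τ => A' K t τ - shB K t τ)
      (badOfClass (HistorySocketTH.bstrOf Prod.fst (memOf ped liveC cellOf)) T
        (fun K _ => badClasses Prod.fst (memOf ped liveC cellOf) jhalf T K)) Cc Rr CcRec RrRec ν u s₂ q₀ r s)
    (hr : Summable r) (hu : Summable u) (hs : Summable s) (hs₂ : Summable s₂) :
    ∃ K₁ K₂, K₀ ≤ K₁ ∧ HybridNE7 l₀ vol (fun K => T (K₁ + (K₂ + K))) (fun K => A (K₁ + (K₂ + K)))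
      (fun K => A' (K₁ + (K₂ + K)))
      (fun K => badOfClass (HistorySocketTH.bstrOf Prod.fst (memOf ped liveC cellOf)) T
        (fun K _ => badClasses Prod.fst (memOf ped liveC cellOf) jhalf T K) (K₁ + (K₂ + K)))
      (fun K => constOf l₀ B (max (em g) 0) n₁ c₀ Nup *
        recordsBudget (birthMass C) C.κ₁ ((n : ℝ) ^ d) ((F.L : ℝ) ^ d) (Real.log 2) jhalf (K₁ + (K₂ + K)))
      (fun K => shA (K₁ + (K₂ + K))) (fun K => shB (K₁ + (K₂ + K))) (fun K => Wsh (K₁ + (K₂ + K)))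
      (fun K => (r (K₁ + (K₂ + K)) + u (K₁ + (K₂ + K))) + (s (K₁ + (K₂ + K)) + s₂ (K₁ + (K₂ + K)))) :=
  have hLpos : (0 : ℝ) < F.L := by exact_mod_cast (lt_of_lt_of_le (by norm_num) (two_le_L F))
  have hΛ : (0 : ℝ) ≤ (F.L : ℝ) ^ d := pow_nonneg hLpos.le d
  hybridNE7_of_realisedReading_canon D h hμ d n hκ₁ hE₀ hb hlo hhi hγ hγβ S hp₀ hrr ht hir hsign hcor hγB hobs hbd hα
    hα' hc₀ hfloor hfloor' hsites hsites' hNup hnup hmup R hR hL4 hdrop hn₁ hR1 ped cellP liveC cellOf (realisedReading_of_pedigrees H)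
    (hprice_of_printed Prod.fst hD hΛ R (fun K => (D.C ⟨K, F.m, g₀ K⟩).flow.g) κ hκ hP)
    (hprice_of_printed Prod.fst hD hΛ R (fun K => (D.C ⟨K, F.m, g₀ K⟩).flow.g) κ' hκ' hP')
    up dead_nonneg resum F_nonneg up' dead'_nonneg resum' F'_nonneg hSh hTB hr hu hs hs₂

end EndPrinted

end

end Summit.QuantumFields.BalabanUV.T4Continuum.HistoryAssemblyRealise
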